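import Literature.NumberTheory.LFunctions.GeneralizedEulerConstants
import Literature.NumberTheory.LFunctions.EulerLehmerConstants
import HarnessLib

/-!
# Generalized Euler constants as harmonic-sum limits; the coprime digamma sum in closed form

Topic `Literature/NumberTheory/LFunctions`. Proofs only (no definitions, no named facts); sequel of
`GeneralizedEulerConstants.lean`.

H. G. Diamond and K. Ford, *Generalized Euler constants*, Math. Proc. Cambridge Philos. Soc. 145
(2008) 27–41 [DiamondFord2008], §1: «the generalized Euler constant
`γ(𝒫) := lim_{x→∞} { Σ_{n≤x} 1_𝒫(n)/n − δ_𝒫 log x }` exists» (`1_𝒫(n) = 1` iff `(n, Π_{p∈𝒫} p) = 1`,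
`δ_𝒫 = Π_{p∈𝒫}(1 − 1/p)`), «it is the constant term in the Laurent series about 1 of …
`ζ(s)Π_{p∈𝒫}(1 − p^{−s})`», and «**Proposition 1.** … `γ(𝒫) = Π_{p∈𝒫}(1 − 1/p){γ + Σ_{p∈𝒫} log p/(p−1)}`.»
Lagarias, Bull. AMS 50 (2013) §3.8: «The constants `γ(Ω)` are easily shown to be finite sums of
Euler–Lehmer constants `γ(Ω) = Σ_{1≤h<P_Ω, gcd(h,P_Ω)=1} γ(h, P_Ω)`.»

Here, for a modulus `N ≥ 1` (the prime set `𝒫 = ` the prime divisors of `N`, `1_𝒫(n) = [gcd(n,N) = 1]`,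
`δ_𝒫 = φ(N)/N`):
* `sum_trivChar_mul_digamma_add_log_eq` — the constant term of `L(s, χ₀ mod N)` computed TWICE — by
  the residue-wise digamma formula (P1 g56's `HurwitzZetaOne.tendsto_LFunction_sub_div`:
  `−N⁻¹ Σ_{a=1}^{N} χ₀(a)(ψ(a/N) + log N)`) and by the Euler-factor product (previous file:
  `(φ(N)/N)(γ + Σ_{p∣N} log p/(p−1))`) — IS ONE NUMBER; hence **the coprime digamma sum in closed
  form**: `Σ_{1≤a≤N, (a,N)=1} ψ(a/N) = −φ(N)·(γ + log N + Σ_{p∣N} log p/(p−1))`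
  (`sum_coprime_digamma_eq`; compare P1 g56's Möbius form `S_q = −γφ(q) − Σ_{d∣q} μ(d)(q/d) log(q/d)`,
  `DigammaRational.sum_coprime_digamma_div_eq`);
* **`tendsto_sum_coprime_inv_sub_log`** — Diamond–Ford's DEFINITION of `γ(𝒫)` meets Proposition 1:
  `Σ_{n≤M, (n,N)=1} 1/n − (φ(N)/N) log M → (φ(N)/N)(γ + Σ_{p∣N} log p/(p−1))`, as the sum over the
  reduced residues `h` of the Euler–Lehmer limits `γ(h,N) = −(ψ(h/N) + log N)/N` (P1 g56's
  `EulerLehmer.tendsto_sum_inv_sub_log_div`; Lagarias's display).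

Cell pub-zeta5 (HONEST FRAMING: systematic search; no irrationality claim unless certified):
printed identities made kernel theorems; nothing here concerns `ζ(5)`.
-/

noncomputable section

open Complex Finset Filter Topology

namespace Literature.NumberTheory.LFunctions

namespace DiamondFord

variable {N : ℕ} [NeZero N]

/-- `Σ_j χ₀(j) = φ(N)` for the principal character mod `N`. [folklore] -/
private theorem sum_trivChar_eq_totient :
    ∑ j : ZMod N, (1 : DirichletCharacter ℂ N) j = (Nat.totient N : ℂ) := by
  classical
  rw [MulChar.sum_one_eq_card_units, ZMod.card_units_eq_totient]

omit [NeZero N] in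
/-- `χ₀(a) = [gcd(a,N) = 1]` on naturals. [folklore] -/
private theorem trivChar_natCast (a : ℕ) :
    (1 : DirichletCharacter ℂ N) (a : ZMod N) = if a.Coprime N then 1 else 0 := by
  split_ifs with h
  · exact MulChar.one_apply ((ZMod.isUnit_iff_coprime a N).2 h)
  · exact MulChar.map_nonunit _ (mt (ZMod.isUnit_iff_coprime a N).1 h)

/-- **One constant term, two computations.** For the principal character `χ₀` mod `N`:
`−N⁻¹ Σ_{a=1}^{N} χ₀(a)(ψ(a/N) + log N) = (φ(N)/N)(γ + Σ_{p∣N} log p/(p−1))` — the residue-wise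
constant term of `L(s,χ₀)` (Murty–Rath Thm 22.2 route) equals the Euler-product one
(Diamond–Ford Proposition 1 route), by uniqueness of the limit along `𝓝[≠] 1`.
[cite: DiamondFord2008, Proposition 1] -/
theorem sum_trivChar_mul_digamma_add_log_eq :
    -(N : ℂ)⁻¹ * ∑ a ∈ Icc 1 N, (1 : DirichletCharacter ℂ N) (a : ZMod N) *
        (Complex.digamma ((a : ℂ) / N) + Real.log N) =
      ((Nat.totient N : ℂ) / N) *
        (Real.eulerMascheroniConstant + ∑ p ∈ N.primeFactors, Complex.log p / ((p : ℂ) - 1)) := by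
  have h1 := Literature.NumberTheory.LFunctions.HurwitzZetaOne.tendsto_LFunction_sub_div
    (N := N) (⇑(1 : DirichletCharacter ℂ N))
  rw [sum_trivChar_eq_totient] at h1
  have h2 := tendsto_LFunctionTrivChar_sub_totient_div N
  exact tendsto_nhds_unique h1 h2

/-- **The coprime digamma sum with the logarithm**: `Σ_{1≤a≤N, (a,N)=1} (ψ(a/N) + log N) =
−φ(N)(γ + Σ_{p∣N} log p/(p−1))`. [cite: DiamondFord2008, Proposition 1] -/
theorem sum_coprime_digamma_add_log_eq :
    ∑ a ∈ (Icc 1 N).filter (fun a => a.Coprime N), (Complex.digamma ((a : ℂ) / N) + Real.log N) =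
      -(Nat.totient N : ℂ) *
        (Real.eulerMascheroniConstant + ∑ p ∈ N.primeFactors, Complex.log p / ((p : ℂ) - 1)) := by
  have hN : (N : ℂ) ≠ 0 := by exact_mod_cast NeZero.ne N
  have h := sum_trivChar_mul_digamma_add_log_eq (N := N)
  rw [Finset.sum_filter]
  have e : ∑ a ∈ Icc 1 N, (if a.Coprime N then (Complex.digamma ((a : ℂ) / N) + Real.log N) else 0) =
      ∑ a ∈ Icc 1 N, (1 : DirichletCharacter ℂ N) (a : ZMod N) * (Complex.digamma ((a : ℂ) / N) + Real.log N) :=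
    Finset.sum_congr rfl fun a _ => by rw [trivChar_natCast]; split_ifs <;> simp
  rw [e]
  have h' := congrArg (fun z => -(N : ℂ) * z) h
  beta_reduce at h'
  rw [← mul_assoc, show -(N : ℂ) * -(N : ℂ)⁻¹ = 1 by field_simp, one_mul] at h'
  rw [h']
  field_simp

omit [NeZero N] in
/-- `#{1 ≤ a ≤ N : (a,N) = 1} = φ(N)`. [folklore] -/
private theorem card_filter_coprime_Icc : ((Icc 1 N).filter (fun a => a.Coprime N)).card = Nat.totient N := by
  have h := Nat.filter_coprime_Ico_eq_totient N 1
  rw [add_comm, Finset.Ico_add_one_right_eq_Icc] at h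
  rw [← h]
  congr 1
  exact Finset.filter_congr fun a _ => Nat.coprime_comm

/-- **The coprime digamma sum in closed form**: `S_N = Σ_{1≤a≤N, (a,N)=1} ψ(a/N) =
−φ(N)·(γ + log N + Σ_{p∣N} log p/(p−1))` (the constant `γ(𝒫)/δ_𝒫 − log N` of Diamond–Ford's
Proposition 1 summed over the reduced residues; compare Murty–Rath's Möbius form of `S_q`).
[cite: DiamondFord2008, Proposition 1] -/
theorem sum_coprime_digamma_eq :
    ∑ a ∈ (Icc 1 N).filter (fun a => a.Coprime N), Complex.digamma ((a : ℂ) / N) =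
      -(Nat.totient N : ℂ) * (Real.eulerMascheroniConstant + Real.log N +
        ∑ p ∈ N.primeFactors, Complex.log p / ((p : ℂ) - 1)) := by
  have h := sum_coprime_digamma_add_log_eq (N := N)
  rw [Finset.sum_add_distrib, Finset.sum_const, card_filter_coprime_Icc, nsmul_eq_mul] at h
  linear_combination h

/-! ### The harmonic-sum form (Diamond–Ford's definition of `γ(𝒫)`) -/

omit [NeZero N] in
/-- For `1 ≤ y ≤ N` and `n ≥ 1`: `n ≡ y (mod N)` iff `(n − 1) mod N + 1 = y`. [folklore] -/
private theorem modEq_iff_sub_one_mod {n y : ℕ} (hn : 1 ≤ n) (hy : y ∈ Icc 1 N) :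
    n ≡ y [MOD N] ↔ (n - 1) % N + 1 = y := by
  obtain ⟨hy1, hyN⟩ := Finset.mem_Icc.1 hy
  have e1 : n = (n - 1) + 1 := by omega
  have e2 : y = (y - 1) + 1 := by omega
  constructor
  · intro h
    rw [e1, e2] at h
    have h' : (n - 1) % N = (y - 1) % N := Nat.ModEq.add_right_cancel' 1 h
    rw [Nat.mod_eq_of_lt (by omega : y - 1 < N)] at h'
    omega
  · intro h
    have h' : (n - 1) % N = (y - 1) % N := by rw [Nat.mod_eq_of_lt (by omega : y - 1 < N)]; omega
    rw [e1, e2]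
    exact Nat.ModEq.add_right 1 h'

omit [NeZero N] in
/-- Regrouping the integers `1 ≤ n ≤ M` coprime to `N` by their residue `1 ≤ h ≤ N`:
`Σ_{h ≤ N, (h,N)=1} Σ_{n ≤ M, n ≡ h (N)} f(n) = Σ_{n ≤ M, (n,N)=1} f(n)`. [folklore] -/
private theorem sum_coprime_sum_modEq_eq (hN : 1 ≤ N) (M : ℕ) (f : ℕ → ℂ) :
    ∑ h ∈ (Icc 1 N).filter (fun h => h.Coprime N), ∑ n ∈ (Icc 1 M).filter (fun n => n ≡ h [MOD N]), f n =
      ∑ n ∈ (Icc 1 M).filter (fun n => n.Coprime N), f n := by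
  rw [← Finset.sum_fiberwise_of_maps_to (s := (Icc 1 M).filter (fun n => n.Coprime N))
    (t := (Icc 1 N).filter (fun h => h.Coprime N)) (g := fun n => (n - 1) % N + 1) (f := f) ?_]
  · refine Finset.sum_congr rfl fun y hy => ?_
    obtain ⟨hyI, hyc⟩ := Finset.mem_filter.1 hy
    refine Finset.sum_congr ?_ fun _ _ => rfl
    ext n
    simp only [Finset.mem_filter, Finset.mem_Icc]
    constructor
    · rintro ⟨hn, hmod⟩
      have hg := (modEq_iff_sub_one_mod hn.1 hyI).1 hmod
      refine ⟨⟨hn, ?_⟩, hg⟩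
      have hg' := Nat.ModEq.gcd_eq hmod
      exact Nat.coprime_iff_gcd_eq_one.2 (hg'.trans (Nat.coprime_iff_gcd_eq_one.1 hyc))
    · rintro ⟨⟨hn, _⟩, hg⟩
      exact ⟨hn, (modEq_iff_sub_one_mod hn.1 hyI).2 hg⟩
  · intro n hn
    obtain ⟨hnI, hnc⟩ := Finset.mem_filter.1 hn
    have hn1 := (Finset.mem_Icc.1 hnI).1
    refine Finset.mem_filter.2 ⟨Finset.mem_Icc.2 ⟨by omega, ?_⟩, ?_⟩
    · have := Nat.mod_lt (n - 1) (by omega : 0 < N)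
      omega
    · have hmod : n ≡ (n - 1) % N + 1 [MOD N] :=
        (modEq_iff_sub_one_mod hn1 (Finset.mem_Icc.2 ⟨by omega, by have := Nat.mod_lt (n - 1) (by omega : 0 < N); omega⟩)).2 rfl
      have hg' := Nat.ModEq.gcd_eq hmod
      exact Nat.coprime_iff_gcd_eq_one.2 (hg'.symm.trans (Nat.coprime_iff_gcd_eq_one.1 hnc))

/-- **Diamond–Ford's `γ(𝒫)` as a harmonic-sum limit, with its value (Proposition 1)**, for
`𝒫 = ` the prime divisors of `N` (`1_𝒫(n) = [gcd(n,N) = 1]`, `δ_𝒫 = φ(N)/N`):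
`Σ_{n ≤ M, (n,N)=1} 1/n − (φ(N)/N) log M → (φ(N)/N)(γ + Σ_{p∣N} log p/(p−1))` as `M → ∞`
(the sum over the reduced residues `h` of the Euler–Lehmer limits `γ(h,N) = −(ψ(h/N)+log N)/N`).
[cite: DiamondFord2008, §1 (definition of γ(𝒫)) and Proposition 1]
[cite: Lagarias2013, §3.8 (γ(Ω) = Σ_{(h,P_Ω)=1} γ(h,P_Ω))] -/
theorem tendsto_sum_coprime_inv_sub_log :
    Tendsto (fun M : ℕ => (∑ n ∈ (Icc 1 M).filter (fun n => n.Coprime N), (1 : ℂ) / n) -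
        (Nat.totient N : ℂ) / N * Real.log M) atTop
      (𝓝 (((Nat.totient N : ℂ) / N) *
        (Real.eulerMascheroniConstant + ∑ p ∈ N.primeFactors, Complex.log p / ((p : ℂ) - 1)))) := by
  have hN1 : 1 ≤ N := NeZero.pos N
  have hNC : (N : ℂ) ≠ 0 := by exact_mod_cast NeZero.ne N
  set H := (Icc 1 N).filter (fun h => h.Coprime N) with hH
  -- the Euler–Lehmer limits, summed over the reduced residues
  have hlim := tendsto_finsetSum H fun h hh =>
    Literature.NumberTheory.LFunctions.EulerLehmer.tendsto_sum_inv_sub_log_div (k := N) (h := h)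
      (Finset.mem_filter.1 hh).1
  -- the value
  have hval : ∑ h ∈ H, -(Complex.digamma ((h : ℂ) / N) + Real.log N) / N =
      ((Nat.totient N : ℂ) / N) *
        (Real.eulerMascheroniConstant + ∑ p ∈ N.primeFactors, Complex.log p / ((p : ℂ) - 1)) := by
    have e : ∑ h ∈ H, -(Complex.digamma ((h : ℂ) / N) + Real.log N) / N =
        -(N : ℂ)⁻¹ * ∑ h ∈ H, (Complex.digamma ((h : ℂ) / N) + Real.log N) := by
      rw [Finset.mul_sum]
      exact Finset.sum_congr rfl fun h _ => by field_simp
    rw [e, hH, sum_coprime_digamma_add_log_eq]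
    field_simp
  rw [hval] at hlim
  refine hlim.congr fun M => ?_
  rw [Finset.sum_sub_distrib, sum_coprime_sum_modEq_eq hN1 M (fun n => (1 : ℂ) / n), Finset.sum_const,
    card_filter_coprime_Icc, nsmul_eq_mul]
  field_simp

/-! ### An arbitrary finite set of primes `𝒫`: `N = Π_{p∈𝒫} p` -/

/-- `Π_{p∣N}(1 − 1/p) = φ(N)/N` in `ℂ`. [folklore] -/
private theorem totient_div_eq_prod (N : ℕ) [NeZero N] :
    (Nat.totient N : ℂ) / N = ∏ p ∈ N.primeFactors, (1 - (p : ℂ)⁻¹) := by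
  have hN : (N : ℂ) ≠ 0 := by exact_mod_cast NeZero.ne N
  have h := congrArg (fun x : ℚ => (x : ℂ)) (Nat.totient_eq_mul_prod_factors N)
  push_cast at h
  rw [div_eq_iff hN, h, mul_comm]

omit [NeZero N] in
/-- **Diamond–Ford's definition of `γ(𝒫)` and Proposition 1, for an arbitrary finite set of primes
`𝒫`**: with `P = Π_{p∈𝒫} p` (so `1_𝒫(n) = [gcd(n,P) = 1]`) and `δ_𝒫 = Π_{p∈𝒫}(1 − 1/p)`,
`Σ_{n≤M} 1_𝒫(n)/n − δ_𝒫 log M → δ_𝒫 · (γ + Σ_{p∈𝒫} log p/(p−1))` as `M → ∞`.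
[cite: DiamondFord2008, §1 (definition of γ(𝒫)) and Proposition 1] -/
theorem tendsto_sum_coprime_prod_inv_sub_log (P : Finset ℕ) (hP : ∀ p ∈ P, p.Prime) :
    Tendsto (fun M : ℕ => (∑ n ∈ (Icc 1 M).filter (fun n => n.Coprime (∏ p ∈ P, p)), (1 : ℂ) / n) -
        (∏ p ∈ P, (1 - (p : ℂ)⁻¹)) * Real.log M) atTop
      (𝓝 ((∏ p ∈ P, (1 - (p : ℂ)⁻¹)) *
        (Real.eulerMascheroniConstant + ∑ p ∈ P, Complex.log p / ((p : ℂ) - 1)))) := by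
  haveI : NeZero (∏ p ∈ P, p) := ⟨(Finset.prod_pos fun p hp => (hP p hp).pos).ne'⟩
  have h := tendsto_sum_coprime_inv_sub_log (N := ∏ p ∈ P, p)
  rw [totient_div_eq_prod, Nat.primeFactors_prod hP] at h
  exact h

end DiamondFord

end Literature.NumberTheory.LFunctions
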